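import Summits.RiemannHypothesis.RiemannHypothesis.Theorems.HandoffUpperClauses
import Summits.RiemannHypothesis.RiemannHypothesis.Theorems.HandoffSemilocalSectorContinuity
import HarnessLib

/-!
# HANDOFF — the whole handoff card through `q = 17` from ONE two-sector bracket at `t = 3/2` (cell rh-explicit, TRACK «HANDOFF», seat theory-2)

HONEST FRAMING. Nothing here bears on the truth of RH. This is PACKAGING for the Monday document (RH-PROMISE Route 1′): the cell's
empirical handoff record for the first seven primes — the lower clauses `H(2), …, H(17)`, the loads `r(q) ≤ 1` of those windows, and the
STRICT wall offsets `δ*(q) > 0` for every prime `q ≤ 19` — follows in the kernel from a SINGLE certificate shape, a two-sector bracket with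
strictly positive lower ends at bandwidth `3/2`:

  `0 < ε_ev(3/2)`, `0 < ε_od(3/2)`  ⟹  the card through `q = 17`  (`handoffCard_of_bracket_three_halves`),

while the RH-free UPPER clauses `0 < r(q)` (`q = 2, 3, 5, 7, 11, 13`) need no hypothesis at all (`HandoffUpperClauses`). The hypothesis is
discharged NUMERICALLY by the custodian-VERIFIED two-lineage objects `t-3-2-Ka-v2{,-odd}` / `t-3-2-Ka-w4` in HOME/EXTREMALS (DATA, not a tree
fact); the two theorem rungs `H(2)`, `H(3)` and the upper clauses are unconditional. The same packaging at `t = 2` (`handoffCard_of_bracket_two`)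
is what ONE t = 2 two-sector bracket would buy: the card through `q = 47`.

References: E. Bombieri, Rend. Mat. Acc. Lincei (9) 11 (2000) §4 (`Bombieri2000Weil`); H. Yoshida, Adv. Stud. Pure Math. 21 (1992) Prop. 6
(p. 320) (`Yoshida1992HermitianForms`).
-/

set_option linter.dupNamespace false  -- the mandated namespace repeats `RiemannHypothesis`

noncomputable section

open Set Literature.NumberTheory.LFunctions
open Summit.RiemannHypothesis.RiemannHypothesis.Theorems
open Summit.RiemannHypothesis.RiemannHypothesis.Theorems.Handoff (ConsecutivePrimes)
open Summit.RiemannHypothesis.RiemannHypothesis.Theorems.HandoffDecomposition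
open Summit.RiemannHypothesis.RiemannHypothesis.Theorems.HandoffSemilocalEnergy
open Summit.RiemannHypothesis.RiemannHypothesis.Theorems.HandoffLoadCeiling
open Summit.RiemannHypothesis.RiemannHypothesis.Theorems.HandoffMarginLaw
open Summit.RiemannHypothesis.RiemannHypothesis.Theorems.HandoffLadderRungs
open Summit.RiemannHypothesis.RiemannHypothesis.Theorems.HandoffLadderTheoremRungs
open Summit.RiemannHypothesis.RiemannHypothesis.Theorems.HandoffSemilocalSectorContinuity
open Summit.RiemannHypothesis.RiemannHypothesis.Theorems.HandoffUpperClauses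

namespace Summit.RiemannHypothesis.RiemannHypothesis.Theorems.HandoffCardFromOneBracket

/-- Loads from rungs: a two-sector certificate `0 ≤ ε_ev(c)`, `0 ≤ ε_od(c)` at bandwidth `c` with `P ≤ e^{2c}` gives `r(q) ≤ 1` for EVERY prime
`q < P` (through `H(q)`, `handoffLoad_le_one_of_handoffH`). [this track] -/
theorem forall_handoffLoad_le_one_of_sector_energies {c : ℝ} {P : ℕ} (hP : P.Prime) (hPc : (P : ℝ) ≤ Real.exp (2 * c))
    (hev : 0 ≤ weilEvenGroundEnergy c) (hod : 0 ≤ weilOddGroundEnergy c) :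
    ∀ q : ℕ, q.Prime → q < P → handoffLoad q (nextPrime q) ≤ 1 := by
  intro q hq hqP
  have hH := forall_handoffH_of_sector_energies hP hPc hev hod q hq hqP
  exact handoffLoad_le_one_of_handoffH (consecutivePrimes_nextPrime hq) hH

/-- **THE CARD THROUGH `q = 17` FROM ONE BRACKET AT `t = 3/2`.** From `0 < ε_ev(3/2)` and `0 < ε_od(3/2)` (the shape of the cell's
custodian-VERIFIED two-lineage t = 3/2 objects): (i) `H(q)` for every prime `q < 19`; (ii) `r(q) ≤ 1` for every prime `q < 19`; (iii) `0 < δ*(q)`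
for every prime `q ≤ 20`; and, with NO hypothesis, (iv) `0 < r(q)` for `q = 2, 3, 5, 7, 11, 13`. [cite: Bombieri2000Weil, §4; Yoshida1992HermitianForms Prop. 6 (p. 320); this track] -/
theorem handoffCard_of_bracket_three_halves (hev : 0 < weilEvenGroundEnergy (3 / 2)) (hod : 0 < weilOddGroundEnergy (3 / 2)) :
    (∀ q : ℕ, q.Prime → q < 19 → HandoffH q) ∧
      (∀ q : ℕ, q.Prime → q < 19 → handoffLoad q (nextPrime q) ≤ 1) ∧
        (∀ q : ℕ, q.Prime → q ≤ 20 → 0 < wallOffset q) ∧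
          (0 < handoffLoad 2 3 ∧ 0 < handoffLoad 3 5 ∧ 0 < handoffLoad 5 7 ∧ 0 < handoffLoad 7 11 ∧
            0 < handoffLoad 11 13 ∧ 0 < handoffLoad 13 17) :=
  ⟨forall_handoffH_of_sector_energies_3_2 hev.le hod.le,
    forall_handoffLoad_le_one_of_sector_energies (by norm_num)
      (natCast_le_exp_of_pow_lt (P := 19) (n := 1) (m := 3) (by norm_num) (by norm_num) (by norm_num)) hev.le hod.le,
    forall_wallOffset_pos_of_sector_energies_3_2 hev hod,
    handoffLoad_two_three_pos, handoffLoad_three_five_pos, handoffLoad_five_seven_pos, handoffLoad_seven_eleven_pos,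
    handoffLoad_eleven_thirteen_pos, handoffLoad_thirteen_seventeen_pos⟩

/-- **What ONE bracket at `t = 2` would buy: the card through `q = 47`** — `H(q)` and `r(q) ≤ 1` for every prime `q < 53`, `0 < δ*(q)` for every
prime `q ≤ 54` (the t = 2 consumer runs' certificate shape; NOT in HOME/EXTREMALS at this write). [this track] -/
theorem handoffCard_of_bracket_two (hev : 0 < weilEvenGroundEnergy 2) (hod : 0 < weilOddGroundEnergy 2) :
    (∀ q : ℕ, q.Prime → q < 53 → HandoffH q) ∧
      (∀ q : ℕ, q.Prime → q < 53 → handoffLoad q (nextPrime q) ≤ 1) ∧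
        (∀ q : ℕ, q.Prime → q ≤ 54 → 0 < wallOffset q) :=
  ⟨forall_handoffH_of_sector_energies_two hev.le hod.le,
    forall_handoffLoad_le_one_of_sector_energies (by norm_num)
      (natCast_le_exp_of_pow_lt (P := 53) (n := 1) (m := 4) (by norm_num) (by norm_num) (by norm_num)) hev.le hod.le,
    forall_wallOffset_pos_of_sector_energies_two hev hod⟩

/-- The UNCONDITIONAL part of the card (no certificate): `H(2)`, `H(3)`; `r(2), r(3) ∈ (0, 1]`; `0 < r(q)` for `q = 5, 7, 11, 13`;
`0 ≤ δ*(3)`, `0 ≤ δ*(5)` with their kernel upper bounds. [this track] -/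
theorem handoffCard_unconditional :
    HandoffH 2 ∧ HandoffH 3 ∧ handoffLoad 2 3 ∈ Ioc (0 : ℝ) 1 ∧ handoffLoad 3 5 ∈ Ioc (0 : ℝ) 1 ∧
      (0 < handoffLoad 5 7 ∧ 0 < handoffLoad 7 11 ∧ 0 < handoffLoad 11 13 ∧ 0 < handoffLoad 13 17) ∧
        wallOffset 3 ∈ Icc (0 : ℝ) (223 / 400 - Real.log 3 / 2) ∧ wallOffset 5 ∈ Icc (0 : ℝ) (163 / 200 - Real.log 5 / 2) :=
  ⟨handoffH_two, handoffH_three, handoffLoad_mem_Ioc_two_three.1, handoffLoad_mem_Ioc_two_three.2,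
    ⟨handoffLoad_five_seven_pos, handoffLoad_seven_eleven_pos, handoffLoad_eleven_thirteen_pos, handoffLoad_thirteen_seventeen_pos⟩,
    wallOffset_three_mem_Icc, wallOffset_five_mem_Icc⟩

end Summit.RiemannHypothesis.RiemannHypothesis.Theorems.HandoffCardFromOneBracket

end
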